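import Mathlib
import Summits.MatrixMultiplication.MatrixMultiplication.Theses.AutomaticSTPPDesigns
import Literature.Computability.AutomaticStructures.AutomaticBlock
import Literature.Computability.AutomaticStructures.DigitPathCount
import Literature.Combinatorics.Additive.TripleProductProperty
import Literature.Computability.AlgebraicComplexity.GroupTheoreticMatMulThmBProofs
import HarnessLib

/-!
# Line `Sketch` for crux `AutomaticSTPPDesigns.RegularTowerGap` (stmt-MatrixMultiplication-7358) — SKELETON

Lead's registered skeleton (prover-line-stmt-MatrixMultiplication-7358-0, 2026-08-16, rev 4), DEF-FREE and
NOTATION-FREE: every stub is stated over Mathlib / tree vocabulary only (`DFA`, `automaticBlock`,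
`AddSimultaneousTPP`); the digit-track path counts enter through CHARACTERISING HYPOTHESES
(`hN : ∀ s s' k w, N s s' k w = #{a | M.evalFrom s (zip w a) = s'}`), so each stub lands verbatim
under `Theorems/AutomaticSTPPDesignsRegularTowerGapStub<Name>.lean` with `--supports`, no Defs review.

**Claim.** For every base `p ≥ 2` and every triple of regular languages over `ι × Fin p` whose
automatic family is STPP in `ℤ/(p^k)` at every scale, `∃ ε > 0`, eventually
`∑_w (|A_w||B_w||C_w|)^{(2+ε)/3} ≤ p^k`.

**Architecture** (composition `regularTowerGap_proof`, kernel-checked modulo the `stub_*`):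
1. `stub_abelianSubPacking` (delegated) — removal: STPP families in a finite abelian group `H` have
   `∑ (|A||B||C|)^{2/3} ≤ η|H|` for `|H| ≥ N₀(η)`.
2. toolkit (PROVED here): path counts, multiplicativity along `Fin.append`,
   `|A_w| = Σ_{accepting} N start ·`, framed sub-blocks ⊆ genuine blocks with the right cardinality.
3. `stub_entrySum_submul` (delegated, LANDED p102380) — trimmed entry sums are submultiplicative.
4. `stub_oneGoodScale` (lead; PROVED in work/final/StubOneGoodScale.lean, registered as a stub so it
   lands as its own `--supports` file) — STPP re-entry: `Z_{2/3}(k₀) < p^{k₀}` at some `k₀ ≥ 1`.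
5. `stub_exponent_bump` (LANDED p102344), `stub_fekete` (LANDED p102336) — move to `τ₀ > 2/3`,
   amplify to all large `k`.
-/

-- single-conjunct summit: the mandated namespace repeats `MatrixMultiplication`.
set_option linter.dupNamespace false

noncomputable section

open Finset

open scoped BigOperators Classical

namespace Summit.MatrixMultiplication.MatrixMultiplication.Theorems.RegularTowerGap

open Literature.Combinatorics.Additive (AddSimultaneousTPP)
open Literature.Computability.AutomaticStructures

/-! ## Transfer-matrix toolkit, through characterising hypotheses

`N s s' k w` is the digit-track PATH COUNT of the DFA `M` (the number of digit words
`a : Fin k → Fin p` driving `s` to `s'` along the index word `w : Fin k → ι`), introduced through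
its characterising equation `hN`; it is the tree's `pathCount M s s' k w`
(`Literature/Computability/AutomaticStructures/DigitPathCount.lean`), whose API is transported. -/

section Toolkit

variable {ι : Type*} {p : ℕ} {σ : Type*} (M : DFA (ι × Fin p) σ)
  (N : σ → σ → (k : ℕ) → (Fin k → ι) → ℕ)
  (hN : ∀ (s s' : σ) (k : ℕ) (w : Fin k → ι), N s s' k w =
    ((Finset.univ : Finset (Fin k → Fin p)).filter
      (fun a => M.evalFrom s (List.ofFn fun j : Fin k => (w j, a j)) = s')).card)

include hN in
/-- The characterising equation says `N = pathCount M`. -/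
theorem count_eq_pathCount (s s' : σ) (k : ℕ) (w : Fin k → ι) :
    N s s' k w = pathCount M s s' k w :=
  hN s s' k w

include hN in
/-- `N s s' k w ≠ 0` iff some digit word drives `s` to `s'` along `w`. -/
theorem count_ne_zero_iff {s s' : σ} {k : ℕ} {w : Fin k → ι} :
    N s s' k w ≠ 0 ↔
      ∃ a : Fin k → Fin p, M.evalFrom s (List.ofFn fun j : Fin k => (w j, a j)) = s' := by
  rw [count_eq_pathCount M N hN]
  exact pathCount_ne_zero_iff M

include hN in
/-- The trivial bound `N s s' k w ≤ p^k`. -/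
theorem count_le (s s' : σ) (k : ℕ) (w : Fin k → ι) : N s s' k w ≤ p ^ k := by
  rw [count_eq_pathCount M N hN]
  exact pathCount_le M s s' k w

include hN in
/-- At length `0` the path-count matrix is the identity. -/
theorem count_zero (s s' : σ) (w : Fin 0 → ι) : N s s' 0 w = if s = s' then 1 else 0 := by
  rw [count_eq_pathCount M N hN]
  exact pathCount_zero M s s' w

include hN in
/-- **Multiplicativity** (the transfer-matrix product along `Fin.append u v`). -/
theorem count_append [Fintype σ] (s s'' : σ) {k l : ℕ} (u : Fin k → ι) (v : Fin l → ι) :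
    N s s'' (k + l) (Fin.append u v) = ∑ s', N s s' k u * N s' s'' l v := by
  simp only [count_eq_pathCount M N hN]
  exact pathCount_append M s s'' u v

include hN in
/-- **`|A_w| = ∑_{s' accepting} N start s' k w`** for the block of the automatic family of
`M.accepts` at the index word `w`. -/
theorem card_automaticBlock_eq_sum_count [Fintype σ] (k : ℕ) (w : Fin k → ι) :
    (automaticBlock p k M.accepts w).card =
      ∑ s' ∈ (Finset.univ : Finset σ).filter (fun s' => s' ∈ M.accept), N M.start s' k w := by
  simp only [count_eq_pathCount M N hN]
  exact card_automaticBlock_eq_sum_pathCount M k w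

end Toolkit

/-- `w ↦ u w v` (framing an index word by a fixed prefix and suffix) is injective. -/
theorem append_append_injective {α : Type*} {m k n : ℕ} (u : Fin m → α) (v : Fin n → α) :
    Function.Injective fun w : Fin k → α => Fin.append (Fin.append u w) v := by
  intro a b h
  have h1 : Fin.append u a = Fin.append u b := by
    have := congrArg (fun c => ((Fin.appendEquiv (m + k) n).symm c).1) h
    simpa only [Fin.appendEquiv, Equiv.coe_fn_symm_mk, Fin.append_left] using this
  have := congrArg (fun c => ((Fin.appendEquiv m k).symm c).2) h1
  simpa only [Fin.appendEquiv, Equiv.coe_fn_symm_mk, Fin.append_right] using this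

/-! ## Stub 1 — removal: STPP families are sub-packed at the critical exponent -/

/-- **Abelian sub-packing** (stub; Green 2005 Thm 1.5 `Green2005_1_5_holds` + Pratt's corrected
sum-of-minima count `sum_min_le_three_mul_card` + AM–GM): for every `η > 0` there is `N₀` such that
every STPP family in a finite abelian group `H` with `|H| ≥ N₀` satisfies
`∑ᵢ (|Aᵢ||Bᵢ||Cᵢ|)^{2/3} ≤ η |H|`. -/
theorem stub_abelianSubPacking :
    ∀ η : ℝ, 0 < η → ∃ N₀ : ℕ, ∀ (H : Type) [AddCommGroup H] [Fintype H] [DecidableEq H],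
      N₀ ≤ Fintype.card H → ∀ (κ : Type) [Fintype κ] (A B C : κ → Finset H),
        AddSimultaneousTPP A B C →
          ∑ i, (((A i).card * (B i).card * (C i).card : ℕ) : ℝ) ^ ((2 : ℝ) / 3) ≤
            η * Fintype.card H := by
  sorry

/-! ## Stub 2 — submultiplicativity of the trimmed entry sums -/

/-- **Entry sums of a multiplicative ℕ-valued cocycle over a convex state set are
submultiplicative** (stub; elementary: `T (uv) = ∑_{q'} T u · T v`, the intermediate `q'` of a
nonzero product lies in `R`, `(∑ y)^τ ≤ ∑ y^τ` for `0 < τ ≤ 1`, and a sum of products of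
nonnegative terms is at most the product of the sums). -/
theorem stub_entrySum_submul :
    ∀ (ι σ : Type) [Fintype ι] [Fintype σ] (T : (k : ℕ) → (Fin k → ι) → σ → σ → ℕ)
      (R : Finset σ) (τ : ℝ), 0 < τ → τ ≤ 1 →
      (∀ (k l : ℕ) (u : Fin k → ι) (v : Fin l → ι) (q q'' : σ),
        T (k + l) (Fin.append u v) q q'' = ∑ q', T k u q q' * T l v q' q'') →
      (∀ (k l : ℕ) (u : Fin k → ι) (v : Fin l → ι) (q q' q'' : σ), q ∈ R → q'' ∈ R →
        T k u q q' ≠ 0 → T l v q' q'' ≠ 0 → q' ∈ R) →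
      ∀ k l : ℕ,
        (∑ w : Fin (k + l) → ι, ∑ q ∈ R, ∑ q' ∈ R, ((T (k + l) w q q' : ℕ) : ℝ) ^ τ) ≤
          (∑ u : Fin k → ι, ∑ q ∈ R, ∑ q' ∈ R, ((T k u q q' : ℕ) : ℝ) ^ τ) *
            ∑ v : Fin l → ι, ∑ q ∈ R, ∑ q' ∈ R, ((T l v q q' : ℕ) : ℝ) ^ τ := by
  sorry

/-! ## Stub 3 — Fekete: one sub-critical scale forces eventual domination -/

/-- **Fekete-type criterion** (stub; elementary): a nonnegative submultiplicative sequence with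
`Z k₀ < P^{k₀}` at one scale `k₀ ≥ 1` satisfies `Z k ≤ P^k` for all large `k`
(`Z (q k₀ + r) ≤ Z(k₀)^q Z(r)` and `(Z k₀ / P^{k₀})^q → 0`). -/
theorem stub_fekete :
    ∀ (Z : ℕ → ℝ) (P : ℝ), 0 < P → (∀ k, 0 ≤ Z k) → (∀ k l, Z (k + l) ≤ Z k * Z l) →
      ∀ k₀ : ℕ, 1 ≤ k₀ → Z k₀ < P ^ k₀ → ∃ K : ℕ, ∀ k ≥ K, Z k ≤ P ^ k := by
  sorry

/-! ## Stub 4 — moving the exponent off `2/3` -/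

/-- **Exponent bump** (stub; elementary: `x^τ ≤ B^{τ - 2/3} x^{2/3}` for `0 ≤ x ≤ B`, `1 ≤ B`, and
`B^t → 1` as `t → 0⁺`): a strict bound on a finite sum of `2/3`-powers of numbers in `[0, B]`
persists at some exponent `τ ∈ (2/3, 1]`. -/
theorem stub_exponent_bump :
    ∀ (α : Type) (s : Finset α) (f : α → ℝ) (B P : ℝ), 1 ≤ B → (∀ i ∈ s, 0 ≤ f i) →
      (∀ i ∈ s, f i ≤ B) → ∑ i ∈ s, f i ^ ((2 : ℝ) / 3) < P →
        ∃ τ : ℝ, 2 / 3 < τ ∧ τ ≤ 1 ∧ ∑ i ∈ s, f i ^ τ < P := by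
  sorry

/-! ## Shrinking STPP families -/

/-- Sub-blocks of an STPP family form an STPP family (both clauses of CKSU Def. 5.1 are universal
statements over the members of the blocks). -/
theorem addSimultaneousTPP_mono {H : Type*} [AddCommGroup H] {κ : Type*}
    {A B C A' B' C' : κ → Finset H} (h : AddSimultaneousTPP A B C) (hA : ∀ i, A' i ⊆ A i)
    (hB : ∀ i, B' i ⊆ B i) (hC : ∀ i, C' i ⊆ C i) : AddSimultaneousTPP A' B' C' :=
  ⟨fun i => (h.1 i).mono (hA i) (hB i) (hC i),
    fun i j k a ha a' ha' b hb b' hb' c hc c' hc' he =>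
      h.2 i j k a (hA i ha) a' (hA j ha') b (hB j hb) b' (hB k hb') c (hC k hc) c' (hC i hc') he⟩

/-! ## One good scale -/

/-- **One good scale** (stub, the line's load-bearing step): for three DFAs whose automatic family
is STPP at all scales and a set `R` of state triples each jointly reachable from the start triple
and jointly co-reachable to an accepting triple, the trimmed entry sum at the critical exponent is
eventually below `p^k`; in particular `Z_{2/3}(k₀) < p^{k₀}` at some `k₀ ≥ 1`. (Each entry is the
size product of an STPP family of sub-blocks at scale `m + k + n`,
`pathBlock_subset_automaticBlock`, and `stub_abelianSubPacking` bounds those by `η p^{m+k+n}`,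
`η` small against `|R|² p^{m+n}`.) The path counts `NA, NB, NC` enter through their
characterising equations. -/
theorem stub_oneGoodScale :
    ∀ (p : ℕ) (ι : Type) [Fintype ι] (σA σB σC : Type) [Fintype σA] [Fintype σB] [Fintype σC]
      (MA : DFA (ι × Fin p) σA) (MB : DFA (ι × Fin p) σB) (MC : DFA (ι × Fin p) σC)
      (NA : σA → σA → (k : ℕ) → (Fin k → ι) → ℕ) (NB : σB → σB → (k : ℕ) → (Fin k → ι) → ℕ)
      (NC : σC → σC → (k : ℕ) → (Fin k → ι) → ℕ),
      (∀ (s s' : σA) (k : ℕ) (w : Fin k → ι), NA s s' k w =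
        ((Finset.univ : Finset (Fin k → Fin p)).filter
          (fun a => MA.evalFrom s (List.ofFn fun j : Fin k => (w j, a j)) = s')).card) →
      (∀ (s s' : σB) (k : ℕ) (w : Fin k → ι), NB s s' k w =
        ((Finset.univ : Finset (Fin k → Fin p)).filter
          (fun a => MB.evalFrom s (List.ofFn fun j : Fin k => (w j, a j)) = s')).card) →
      (∀ (s s' : σC) (k : ℕ) (w : Fin k → ι), NC s s' k w =
        ((Finset.univ : Finset (Fin k → Fin p)).filter
          (fun a => MC.evalFrom s (List.ofFn fun j : Fin k => (w j, a j)) = s')).card) →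
      2 ≤ p →
      (∀ k : ℕ, AddSimultaneousTPP (automaticBlock p k MA.accepts) (automaticBlock p k MB.accepts)
        (automaticBlock p k MC.accepts)) →
      ∀ R : Finset (σA × σB × σC),
        (∀ q ∈ R,
          (∃ (m : ℕ) (u : Fin m → ι), NA MA.start q.1 m u * NB MB.start q.2.1 m u *
              NC MC.start q.2.2 m u ≠ 0) ∧
          (∃ (n : ℕ) (v : Fin n → ι) (f : σA × σB × σC),
              (f.1 ∈ MA.accept ∧ f.2.1 ∈ MB.accept ∧ f.2.2 ∈ MC.accept) ∧
              NA q.1 f.1 n v * NB q.2.1 f.2.1 n v *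
                NC q.2.2 f.2.2 n v ≠ 0)) →
        ∃ k₀ : ℕ, 1 ≤ k₀ ∧
          ∑ w : Fin k₀ → ι, ∑ q ∈ R, ∑ q' ∈ R,
            ((NA q.1 q'.1 k₀ w * NB q.2.1 q'.2.1 k₀ w *
                NC q.2.2 q'.2.2 k₀ w : ℕ) : ℝ) ^ ((2 : ℝ) / 3) < (p : ℝ) ^ k₀ := by
  sorry

/-! ## Glue: triple products of sums; finite subadditivity of `t ↦ t^τ` -/

/-- `(∑ f)(∑ g)(∑ h) = ∑ over the product set of `f · g · h`. -/
theorem sum_mul_sum_mul_sum {α β γ R : Type*} [CommSemiring R] (s : Finset α) (t : Finset β)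
    (r : Finset γ) (f : α → R) (g : β → R) (h : γ → R) :
    (∑ a ∈ s, f a) * (∑ b ∈ t, g b) * (∑ c ∈ r, h c) =
      ∑ x ∈ s ×ˢ (t ×ˢ r), f x.1 * g x.2.1 * h x.2.2 := by
  rw [Finset.sum_product, Finset.sum_mul_sum, Finset.sum_mul]
  refine Finset.sum_congr rfl fun a _ => ?_
  rw [Finset.sum_product, Finset.sum_mul]
  refine Finset.sum_congr rfl fun b _ => ?_
  rw [Finset.mul_sum]

/-! ### finite subadditivity of `t ↦ t^τ` -/

/-- `(∑ᵢ xᵢ)^τ ≤ ∑ᵢ xᵢ^τ` for nonnegative reals and `0 < τ ≤ 1`. -/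
theorem rpow_sum_le_sum_rpow {α : Type*} (s : Finset α) (f : α → ℝ) (hf : ∀ i ∈ s, 0 ≤ f i)
    {τ : ℝ} (hτ : 0 < τ) (hτ1 : τ ≤ 1) :
    (∑ i ∈ s, f i) ^ τ ≤ ∑ i ∈ s, f i ^ τ := by
  induction s using Finset.induction_on with
  | empty => simp [Real.zero_rpow hτ.ne']
  | insert a s ha ih =>
    have hfa : 0 ≤ f a := hf a (Finset.mem_insert_self _ _)
    have hfs : ∀ i ∈ s, 0 ≤ f i := fun i hi => hf i (Finset.mem_insert_of_mem hi)
    rw [Finset.sum_insert ha, Finset.sum_insert ha]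
    calc (f a + ∑ i ∈ s, f i) ^ τ ≤ f a ^ τ + (∑ i ∈ s, f i) ^ τ :=
          Real.rpow_add_le_add_rpow hfa (Finset.sum_nonneg hfs) hτ.le hτ1
      _ ≤ f a ^ τ + ∑ i ∈ s, f i ^ τ := add_le_add le_rfl (ih hfs)

/-! ## The composition -/

/-- **`RegularTowerGap`** (crux stmt-MatrixMultiplication-7358, exact route signature
`Summit.MatrixMultiplication.MatrixMultiplication.Theses.AutomaticSTPPDesigns.RegularTowerGap`):
for every base `p ≥ 2` and every triple of regular languages over `ι × Fin p` whose automatic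
family is STPP in `ℤ/(p^k)` at every scale, there is `ε > 0` such that eventually
`∑_w (|A_w||B_w||C_w|)^{(2+ε)/3} ≤ p^k`. Removal (`stub_abelianSubPacking`, inside
`stub_oneGoodScale`) gives one sub-critical scale of the trimmed transfer-matrix entry sum, and
submultiplicativity (`stub_entrySum_submul`, `stub_fekete`) amplifies it to an exponential gap. -/
theorem regularTowerGap_proof :
    Summit.MatrixMultiplication.MatrixMultiplication.Theses.AutomaticSTPPDesigns.RegularTowerGap :=
    by
  intro p ι _ LA LB LC hp hA hB hC
  show (∀ k : ℕ, AddSimultaneousTPP (automaticBlock p k LA) (automaticBlock p k LB)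
      (automaticBlock p k LC)) →
    ∃ ε : ℝ, 0 < ε ∧ ∃ k₀ : ℕ, ∀ k ≥ k₀, ∑ w : Fin k → ι,
      (((automaticBlock p k LA w).card * (automaticBlock p k LB w).card *
        (automaticBlock p k LC w).card : ℕ) : ℝ) ^ ((2 + ε) / 3) ≤ (p : ℝ) ^ k
  intro hS
  obtain ⟨σA, _, MA, rfl⟩ := hA
  obtain ⟨σB, _, MB, rfl⟩ := hB
  obtain ⟨σC, _, MC, rfl⟩ := hC
  -- the digit-track path counts of the three automata, through their characterising equations
  obtain ⟨NA, hNA⟩ : ∃ NA : σA → σA → (k : ℕ) → (Fin k → ι) → ℕ, ∀ s s' k w, NA s s' k w =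
      ((Finset.univ : Finset (Fin k → Fin p)).filter
        (fun a => MA.evalFrom s (List.ofFn fun j : Fin k => (w j, a j)) = s')).card :=
    ⟨_, fun _ _ _ _ => rfl⟩
  obtain ⟨NB, hNB⟩ : ∃ NB : σB → σB → (k : ℕ) → (Fin k → ι) → ℕ, ∀ s s' k w, NB s s' k w =
      ((Finset.univ : Finset (Fin k → Fin p)).filter
        (fun a => MB.evalFrom s (List.ofFn fun j : Fin k => (w j, a j)) = s')).card :=
    ⟨_, fun _ _ _ _ => rfl⟩
  obtain ⟨NC, hNC⟩ : ∃ NC : σC → σC → (k : ℕ) → (Fin k → ι) → ℕ, ∀ s s' k w, NC s s' k w =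
      ((Finset.univ : Finset (Fin k → Fin p)).filter
        (fun a => MC.evalFrom s (List.ofFn fun j : Fin k => (w j, a j)) = s')).card :=
    ⟨_, fun _ _ _ _ => rfl⟩
  have hp0 : (0 : ℝ) < p := by exact_mod_cast (by omega : 0 < p)
  have hp1 : (1 : ℝ) ≤ p := by exact_mod_cast (by omega : 1 ≤ p)
  -- the joint transfer count and its structure
  set q₀ : σA × σB × σC := (MA.start, MB.start, MC.start) with hq₀
  set T : (k : ℕ) → (Fin k → ι) → σA × σB × σC → σA × σB × σC → ℕ := fun k w q q' =>
    NA q.1 q'.1 k w * NB q.2.1 q'.2.1 k w * NC q.2.2 q'.2.2 k w with hT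
  have T_append : ∀ (k l : ℕ) (u : Fin k → ι) (v : Fin l → ι) (q q'' : σA × σB × σC),
      T (k + l) (Fin.append u v) q q'' = ∑ q', T k u q q' * T l v q' q'' := by
    intro k l u v q q''
    simp only [hT, count_append MA NA hNA, count_append MB NB hNB,
      count_append MC NC hNC]
    rw [sum_mul_sum_mul_sum, Finset.univ_product_univ, Finset.univ_product_univ]
    refine Finset.sum_congr rfl fun x _ => ?_
    ring
  have T_zero : ∀ (w : Fin 0 → ι) (q q' : σA × σB × σC), T 0 w q q' = if q = q' then 1 else 0 := by
    intro w q q'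
    simp only [hT, count_zero MA NA hNA, count_zero MB NB hNB, count_zero MC NC hNC]
    obtain ⟨a, b, c⟩ := q
    obtain ⟨a', b', c'⟩ := q'
    by_cases ha : a = a' <;> by_cases hb : b = b' <;> by_cases hc : c = c' <;>
      simp [ha, hb, hc]
  -- accepting triples and the trimmed state set
  set Facc : Finset (σA × σB × σC) :=
    (Finset.univ.filter fun a : σA => a ∈ MA.accept) ×ˢ
      ((Finset.univ.filter fun b : σB => b ∈ MB.accept) ×ˢ
        (Finset.univ.filter fun c : σC => c ∈ MC.accept)) with hFacc
  have mem_Facc : ∀ f : σA × σB × σC,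
      f ∈ Facc ↔ f.1 ∈ MA.accept ∧ f.2.1 ∈ MB.accept ∧ f.2.2 ∈ MC.accept := by
    intro f
    simp only [hFacc, Finset.mem_product, Finset.mem_filter, Finset.mem_univ, true_and]
  set R : Finset (σA × σB × σC) := Finset.univ.filter fun q =>
    (∃ (m : ℕ) (u : Fin m → ι), T m u q₀ q ≠ 0) ∧
      ∃ (n : ℕ) (v : Fin n → ι) (f : σA × σB × σC), f ∈ Facc ∧ T n v q f ≠ 0 with hR
  have mem_R : ∀ q, q ∈ R ↔ (∃ (m : ℕ) (u : Fin m → ι), T m u q₀ q ≠ 0) ∧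
      ∃ (n : ℕ) (v : Fin n → ι) (f : σA × σB × σC), f ∈ Facc ∧ T n v q f ≠ 0 := by
    intro q
    simp only [hR, Finset.mem_filter, Finset.mem_univ, true_and]
  -- a nonzero product of entries has its intermediate state in `R`
  have T_append_ne : ∀ (k l : ℕ) (u : Fin k → ι) (v : Fin l → ι) (q q' q'' : σA × σB × σC),
      T k u q q' ≠ 0 → T l v q' q'' ≠ 0 → T (k + l) (Fin.append u v) q q'' ≠ 0 := by
    intro k l u v q q' q'' h1 h2
    rw [T_append]
    intro h0
    have hle : T k u q q' * T l v q' q'' ≤ ∑ x, T k u q x * T l v x q'' :=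
      Finset.single_le_sum (f := fun x => T k u q x * T l v x q'') (fun _ _ => Nat.zero_le _)
        (Finset.mem_univ q')
    rw [h0, Nat.le_zero, mul_eq_zero] at hle
    exact hle.elim h1 h2
  have R_closed : ∀ (k l : ℕ) (u : Fin k → ι) (v : Fin l → ι) (q q' q'' : σA × σB × σC),
      q ∈ R → q'' ∈ R → T k u q q' ≠ 0 → T l v q' q'' ≠ 0 → q' ∈ R := by
    intro k l u v q q' q'' hq hq'' h1 h2
    rw [mem_R] at hq hq'' ⊢
    obtain ⟨⟨m, u₀, hu₀⟩, -⟩ := hq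
    obtain ⟨-, ⟨n, v₀, f, hf, hv₀⟩⟩ := hq''
    exact ⟨⟨m + k, Fin.append u₀ u, T_append_ne _ _ _ _ _ _ _ hu₀ h1⟩,
      ⟨l + n, Fin.append v v₀, f, hf, T_append_ne _ _ _ _ _ _ _ h2 hv₀⟩⟩
  -- the size products are start rows of `T` summed over accepting triples
  have x_eq : ∀ (k : ℕ) (w : Fin k → ι),
      (automaticBlock p k MA.accepts w).card * (automaticBlock p k MB.accepts w).card *
          (automaticBlock p k MC.accepts w).card = ∑ f ∈ Facc, T k w q₀ f := by
    intro k w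
    rw [card_automaticBlock_eq_sum_count MA NA hNA, card_automaticBlock_eq_sum_count MB NB hNB,
      card_automaticBlock_eq_sum_count MC NC hNC, sum_mul_sum_mul_sum]
  -- the trimmed entry sums `Z τ k`
  set Z : ℝ → ℕ → ℝ := fun τ k =>
    ∑ w : Fin k → ι, ∑ q ∈ R, ∑ q' ∈ R, ((T k w q q' : ℕ) : ℝ) ^ τ with hZ
  have Z_nonneg : ∀ τ k, 0 ≤ Z τ k := fun τ k =>
    Finset.sum_nonneg fun _ _ => Finset.sum_nonneg fun _ _ => Finset.sum_nonneg fun _ _ =>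
      Real.rpow_nonneg (Nat.cast_nonneg _) _
  -- domination `F_τ(k) ≤ Z_τ(k)` for `0 < τ ≤ 1`
  have F_le_Z : ∀ (τ : ℝ), 0 < τ → τ ≤ 1 → ∀ k : ℕ,
      ∑ w : Fin k → ι, (((automaticBlock p k MA.accepts w).card *
        (automaticBlock p k MB.accepts w).card *
          (automaticBlock p k MC.accepts w).card : ℕ) : ℝ) ^ τ ≤ Z τ k := by
    intro τ hτ hτ1 k
    simp only [hZ]
    refine Finset.sum_le_sum fun w _ => ?_
    rw [x_eq]
    -- either the start row vanishes on accepting triples, or `q₀ ∈ R`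
    by_cases h0 : ∀ f ∈ Facc, T k w q₀ f = 0
    · rw [Finset.sum_eq_zero h0, Nat.cast_zero, Real.zero_rpow hτ.ne']
      exact Finset.sum_nonneg fun _ _ => Finset.sum_nonneg fun _ _ =>
        Real.rpow_nonneg (Nat.cast_nonneg _) _
    push Not at h0
    obtain ⟨f₀, hf₀, hTf₀⟩ := h0
    have hq₀R : q₀ ∈ R := by
      rw [mem_R]
      refine ⟨⟨0, Fin.elim0, ?_⟩, ⟨k, w, f₀, hf₀, hTf₀⟩⟩
      rw [T_zero, if_pos rfl]; exact one_ne_zero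
    have hfR : ∀ f ∈ Facc, T k w q₀ f ≠ 0 → f ∈ R := by
      intro f hf hTf
      rw [mem_R]
      refine ⟨⟨k, w, hTf⟩, ⟨0, Fin.elim0, f, hf, ?_⟩⟩
      rw [T_zero, if_pos rfl]; exact one_ne_zero
    calc (((∑ f ∈ Facc, T k w q₀ f : ℕ) : ℝ)) ^ τ
        = (∑ f ∈ Facc, ((T k w q₀ f : ℕ) : ℝ)) ^ τ := by rw [Nat.cast_sum]
      _ ≤ ∑ f ∈ Facc, ((T k w q₀ f : ℕ) : ℝ) ^ τ :=
          rpow_sum_le_sum_rpow _ _ (fun _ _ => Nat.cast_nonneg _) hτ hτ1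
      _ = ∑ f ∈ Facc.filter (fun f => T k w q₀ f ≠ 0), ((T k w q₀ f : ℕ) : ℝ) ^ τ := by
          rw [Finset.sum_filter]
          refine Finset.sum_congr rfl fun f _ => ?_
          by_cases h : T k w q₀ f ≠ 0
          · rw [if_pos h]
          · rw [if_neg h]
            push Not at h
            rw [h, Nat.cast_zero, Real.zero_rpow hτ.ne']
      _ ≤ ∑ q' ∈ R, ((T k w q₀ q' : ℕ) : ℝ) ^ τ := by
          refine Finset.sum_le_sum_of_subset_of_nonneg (fun f hf => ?_)
            (fun _ _ _ => Real.rpow_nonneg (Nat.cast_nonneg _) _)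
          rw [Finset.mem_filter] at hf
          exact hfR f hf.1 hf.2
      _ ≤ ∑ q ∈ R, ∑ q' ∈ R, ((T k w q q' : ℕ) : ℝ) ^ τ :=
          Finset.single_le_sum (f := fun q => ∑ q' ∈ R, ((T k w q q' : ℕ) : ℝ) ^ τ)
            (fun _ _ => Finset.sum_nonneg fun _ _ => Real.rpow_nonneg (Nat.cast_nonneg _) _) hq₀R
  -- one good scale at `τ = 2/3` (removal, via the stub)
  have hRwit : ∀ q ∈ R,
      (∃ (m : ℕ) (u : Fin m → ι), NA MA.start q.1 m u * NB MB.start q.2.1 m u *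
          NC MC.start q.2.2 m u ≠ 0) ∧
      (∃ (n : ℕ) (v : Fin n → ι) (f : σA × σB × σC),
          (f.1 ∈ MA.accept ∧ f.2.1 ∈ MB.accept ∧ f.2.2 ∈ MC.accept) ∧
          NA q.1 f.1 n v * NB q.2.1 f.2.1 n v *
            NC q.2.2 f.2.2 n v ≠ 0) := by
    intro q hq
    rw [mem_R] at hq
    obtain ⟨⟨m, u, hu⟩, ⟨n, v, f, hf, hv⟩⟩ := hq
    exact ⟨⟨m, u, hu⟩, ⟨n, v, f, (mem_Facc f).1 hf, hv⟩⟩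
  obtain ⟨k₀, hk₀, hgood⟩ := stub_oneGoodScale p ι σA σB σC MA MB MC NA NB NC hNA hNB hNC hp hS
    R hRwit
  have hgood' : Z ((2 : ℝ) / 3) k₀ < (p : ℝ) ^ k₀ := hgood
  -- bump the exponent
  have hbump : ∃ τ : ℝ, 2 / 3 < τ ∧ τ ≤ 1 ∧ Z τ k₀ < (p : ℝ) ^ k₀ := by
    have hflat : ∀ τ : ℝ, Z τ k₀ =
        ∑ x ∈ (Finset.univ : Finset (Fin k₀ → ι)) ×ˢ (R ×ˢ R),
          ((T k₀ x.1 x.2.1 x.2.2 : ℕ) : ℝ) ^ τ := by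
      intro τ
      simp only [hZ]
      rw [Finset.sum_product]
      refine Finset.sum_congr rfl fun w _ => ?_
      rw [Finset.sum_product]
    have hB : (1 : ℝ) ≤ ((p : ℝ) ^ k₀) ^ 3 := one_le_pow₀ (one_le_pow₀ hp1)
    obtain ⟨τ, hτ, hτ1, hlt⟩ := stub_exponent_bump _
      ((Finset.univ : Finset (Fin k₀ → ι)) ×ˢ (R ×ˢ R))
      (fun x => ((T k₀ x.1 x.2.1 x.2.2 : ℕ) : ℝ)) (((p : ℝ) ^ k₀) ^ 3) ((p : ℝ) ^ k₀) hB
      (fun _ _ => Nat.cast_nonneg _)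
      (fun x _ => by
        have h1 := count_le MA NA hNA x.2.1.1 x.2.2.1 k₀ x.1
        have h2 := count_le MB NB hNB x.2.1.2.1 x.2.2.2.1 k₀ x.1
        have h3 := count_le MC NC hNC x.2.1.2.2 x.2.2.2.2 k₀ x.1
        have h : T k₀ x.1 x.2.1 x.2.2 ≤ (p ^ k₀) ^ 3 := by
          calc T k₀ x.1 x.2.1 x.2.2 ≤ p ^ k₀ * p ^ k₀ * p ^ k₀ :=
                Nat.mul_le_mul (Nat.mul_le_mul h1 h2) h3
            _ = (p ^ k₀) ^ 3 := by ring
        exact_mod_cast h)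
      (by rw [← hflat]; exact hgood')
    exact ⟨τ, hτ, hτ1, by rw [hflat]; exact hlt⟩
  obtain ⟨τ, hτ, hτ1, hZlt⟩ := hbump
  have hτ0 : 0 < τ := by linarith
  -- Fekete amplification
  have hsub : ∀ k l, Z τ (k + l) ≤ Z τ k * Z τ l :=
    stub_entrySum_submul ι (σA × σB × σC) T R τ hτ0 hτ1 T_append R_closed
  obtain ⟨K, hK⟩ := stub_fekete (Z τ) p hp0 (Z_nonneg τ) hsub k₀ hk₀ hZlt
  -- conclusion with `ε = 3τ - 2`
  refine ⟨3 * τ - 2, by linarith, K, fun k hk => ?_⟩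
  have hexp : (2 + (3 * τ - 2)) / 3 = τ := by ring
  rw [hexp]
  exact (F_le_Z τ hτ0 hτ1 k).trans (hK k hk)

end Summit.MatrixMultiplication.MatrixMultiplication.Theorems.RegularTowerGap
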